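import Summits.CriticalPhenomena.SAWScalingLimit.Theses.SAWRenewalTightness
import Literature.Probability.RandomPlanarGeometry.CurveTortuosity
import Literature.Probability.RandomPlanarGeometry.CurveTightness
import Literature.Probability.RandomPlanarGeometry.SAWCount

/-!
# Sketch — crux-ideate stmt-CriticalPhenomena-1372 (`EventualTight`), ideator 1, round 1

Typed first lemmas / atoms for two crux idea cards:

* card `one-atom-no-exponent`: `ShellCountTight` (per fixed shell, the traversal count of the
  critical SAW polyline is a tight family along `δ → 0`), the criterion
  `TightOfShellCount : ShellCountTight → EventualTight` (FIRST LEMMA, provable now from the tree's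
  Aizenman–Burchard Lemma 4.1 `CurveClass.isCompact_closure_image_mk_of_tortuosity_le` and the
  greedy division `Curve.tortuosity_le_of_cover`), its converse, the bulk restriction
  `BulkShellCountTight`, and the single rate-free atom `VirginShellCount` with the reduction
  `BulkOfVirgin : VirginShellCount → BulkShellCountTight` (exact two-sided virginisation).
* card `leaf-peeling`: the one-excursion rate atom `PocketExcursion` and the line shape
  `PeelingLine : PocketExcursion → VirginShellCount`.

Everything is stated over existing declarations; nothing here is proved.
-/

noncomputable section

open MeasureTheory Set Metric Finset
open Literature.Probability.RandomPlanarGeometry Literature.Probability.LatticeModels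

namespace Summit.CriticalPhenomena.SAWScalingLimit.Cruxes.EventualTight.Ideator1

/-- The crux, by name (all route copies are syntactically equal; ledger: stmt-1372 ↔ 1881 ↔ 4922). -/
abbrev Crux : Prop := Summit.CriticalPhenomena.SAWScalingLimit.Theses.SAWRenewalTightness.EventualTight

/-! ## Card 1 — the no-exponent criterion -/

/-- **ShellCountTight** (the transfer target `C⁺` of card `one-atom-no-exponent`): for every
Dobrushin domain and endpoint approximation there is `δ₀ > 0` such that for every FIXED shell
`D(x; ρ, R)` the number of separate traversals of the shell by the critical SAW polyline is a tight
family of `ℕ`-valued random variables over `δ ∈ (0, δ₀]`: for every `η > 0` some threshold `k`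
is exceeded with probability `≤ η`, uniformly in `δ`. No rate in `k`, no uniformity in the shell,
no exponent. -/
def ShellCountTight : Prop :=
  ∀ (D : DobrushinDomain) (a b : ℝ → Site 2), SAW.IsEndpointApprox D a b →
    ∃ δ₀ : ℝ, 0 < δ₀ ∧ ∀ (x : ℂ) (ρ R : ℝ), 0 < ρ → ρ < R → ∀ η : ℝ, 0 < η →
      ∃ k : ℕ, ∀ δ ∈ Set.Ioc (0 : ℝ) δ₀,
        SAW.law D.carrier δ (a δ) (b δ)
          {γ | (⟨γ.walk.toCurve (meshPoint δ)⟩ : Curve ℂ).HasTraversals k x ρ R}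
          ≤ ENNReal.ofReal η

/-- **FIRST LEMMA of card 1** (provable now, size M): the no-exponent tightness criterion.
Proof plan: confinement of the polylines in a compact `Λ ⊇ closure Ω` (the tree's
`z2_window_compact` / `curve_range_subset_closure_of_ne` pattern), scales `ℓ_n = 2^{-n}`, finite
`ℓ_n/8`-nets `S_n` of `Λ`; for `ε > 0` choose per-net-point thresholds `k_n(y)` with
`P_δ ≤ ε 2^{-n-1}/#S_n` by `ShellCountTight`; off an event of probability `≤ ε` the greedy bound
`Curve.tortuosity_le_of_cover` gives `M(γ, ℓ_n) ≤ Φ n := ∑_{y ∈ S_n} k_n(y)` for all `n`, hence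
membership in the compact set of `CurveClass.isCompact_closure_image_mk_of_tortuosity_le`. -/
def TightOfShellCount : Prop := ShellCountTight → Crux

/-- The converse (AB99 Lemma 4.1, "only if"; not needed by the line, recorded to show the transfer
is an EQUIVALENCE): on a compact set of `CurveClass ℂ` the tortuosity `M(·, ℓ)` is bounded for
every `ℓ`, and `k` traversals of `D(x;ρ,R)` force `M(γ, (R-ρ)/2) ≥ k/2`. -/
def ShellCountOfTight : Prop := Crux → ShellCountTight

/-- The bulk part of `ShellCountTight`: shells whose quadruple disc `B̄(x, 4R)` lies inside the
open domain (then `a δ, b δ ∉ B̄(x,4R)` eventually, automatically). -/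
def BulkShellCountTight : Prop :=
  ∀ (D : DobrushinDomain) (a b : ℝ → Site 2), SAW.IsEndpointApprox D a b →
    ∃ δ₀ : ℝ, 0 < δ₀ ∧ ∀ (x : ℂ) (ρ R : ℝ), 0 < ρ → ρ < R →
      Metric.closedBall x (4 * R) ⊆ D.carrier → ∀ η : ℝ, 0 < η →
      ∃ k : ℕ, ∀ δ ∈ Set.Ioc (0 : ℝ) δ₀,
        SAW.law D.carrier δ (a δ) (b δ)
          {γ | (⟨γ.walk.toCurve (meshPoint δ)⟩ : Curve ℂ).HasTraversals k x ρ R}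
          ≤ ENNReal.ofReal η

/-! ### Lattice-unit arc masses (the virgin-disc atom lives on `ℤ²`, scale-free) -/

/-- The `x_c`-mass of self-avoiding arcs of `ℤ²` from `u` to `u'` all of whose vertices lie in
the finite region `Λ` (vertex functions `ω`, `ω 0 = 0`, translated by `u`; lengths `n ≤ #Λ`
suffice since the arc visits distinct vertices of `Λ`). -/
def arcMass (Λ : Finset (Site 2)) (u u' : Site 2) : ℝ :=
  ∑ n ∈ Finset.range (Λ.card + 1),
    ∑ _ω ∈ (SAW.Zd.sawFun 2 n (u' - u)).filter (fun ω => ∀ i ≤ n, u + ω i ∈ Λ),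
      SAW.criticalFugacity ^ n

/-- `m` separate traversals of the shell `D(z; r, R)` (lattice units) by the vertex sequence of an
`n`-step arc `i ↦ u + ω i`: `m` index pairs `s j ≤ t j ≤ n` on pairwise disjoint, increasing index
intervals, one endpoint within `r` of `z`, the other beyond `R` (Aizenman–Burchard's notion,
`Curve.HasTraversals`, read on the vertices). -/
def VertexTraversals (u : Site 2) (ω : ℕ → Site 2) (n m : ℕ) (z : ℂ) (r R : ℝ) : Prop :=
  ∃ s t : Fin m → ℕ, (∀ j, s j ≤ t j ∧ t j ≤ n ∧
      ((dist (Site.toComplex (u + ω (s j))) z ≤ r ∧ R ≤ dist (Site.toComplex (u + ω (t j))) z) ∨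
       (R ≤ dist (Site.toComplex (u + ω (s j))) z ∧ dist (Site.toComplex (u + ω (t j))) z ≤ r))) ∧
    ∀ ⦃i j : Fin m⦄, i < j → t i < s j

open Classical in
/-- The `x_c`-mass of arcs from `u` to `u'` in `Λ` making at least `m` separate traversals of the
shell `D(z; r, R)`. -/
def oscMass (Λ : Finset (Site 2)) (u u' : Site 2) (m : ℕ) (z : ℂ) (r R : ℝ) : ℝ :=
  ∑ n ∈ Finset.range (Λ.card + 1),
    ∑ _ω ∈ ((SAW.Zd.sawFun 2 n (u' - u)).filter (fun ω => ∀ i ≤ n, u + ω i ∈ Λ)).filter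
        (fun ω => VertexTraversals u ω n m z r R),
      SAW.criticalFugacity ^ n

/-- **VirginShellCount** — the single rate-free atom of card `one-atom-no-exponent`.
For every `η > 0` there are `m` and `N₀` such that for all `N ≥ N₀`, every centre `z`, every finite
region `Λ ⊆ ℤ²` containing the FULL lattice disc `B(z, 4N)` (virgin disc), and every two doors
`u, u' ∈ Λ` near its rim (`4N - 2 ≤ |u - z|, |u' - z| ≤ 4N + 2`), the `x_c`-mass of arcs from `u`
to `u'` in `Λ` with `≥ m` separate traversals of the middle shell `D(z; N, 2N)` is at most `η`
times the mass of all arcs from `u` to `u'` in `Λ`. One aspect ratio, a sup over the outside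
`Λ ∖ B(z,4N)` and the doors, any decay in `m` (no rate), lattice units (scale-free in `δ`). -/
def VirginShellCount : Prop :=
  ∀ η : ℝ, 0 < η → ∃ m N₀ : ℕ, ∀ N : ℕ, N₀ ≤ N →
    ∀ (z : ℂ) (Λ : Finset (Site 2)) (u u' : Site 2),
      (∀ v : Site 2, dist (Site.toComplex v) z < 4 * N → v ∈ Λ) →
      u ∈ Λ → u' ∈ Λ →
      4 * (N : ℝ) - 2 ≤ dist (Site.toComplex u) z → dist (Site.toComplex u) z ≤ 4 * N + 2 →
      4 * (N : ℝ) - 2 ≤ dist (Site.toComplex u') z → dist (Site.toComplex u') z ≤ 4 * N + 2 →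
      oscMass Λ u u' m z N (2 * N) ≤ η * arcMass Λ u u'

/-- The exact reduction (two-sided Gibbs conditioning at the first entrance into / last exit from
`B̄(x, 4R)`, the `δℤ²` copy of the hex `Virginization`; provable now, size M–L):
`VirginShellCount → BulkShellCountTight`. -/
def BulkOfVirgin : Prop := VirginShellCount → BulkShellCountTight

/-- Shape of card 1's line: criterion + virgin atom + a boundary/endpoint-shell companion
(shells meeting `∂Ω` or containing `a_δ`/`b_δ`, each a FIXED geometry with shell-dependent
constants) give the crux. -/
def LineShape₁ (BoundaryShellCountTight : Prop) : Prop :=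
  VirginShellCount → BoundaryShellCountTight →
    (BulkShellCountTight → BoundaryShellCountTight → ShellCountTight) → Crux

open Classical in
/-- The `x_c`-mass of arcs from `u` to `u'` in `Λ` with `≥ m` separate traversals of `D(z; N, 2N)`
but FEWER than `j` separate traversals of the exit shell `D(z; 4N, (4+ε)N)` (excursions beyond the
virgin disc are capped). -/
def oscCapMass (Λ : Finset (Site 2)) (u u' : Site 2) (m j : ℕ) (z : ℂ) (N ε : ℝ) : ℝ :=
  ∑ n ∈ Finset.range (Λ.card + 1),
    ∑ _ω ∈ ((SAW.Zd.sawFun 2 n (u' - u)).filter (fun ω => ∀ i ≤ n, u + ω i ∈ Λ)).filter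
        (fun ω => VertexTraversals u ω n m z N (2 * N) ∧
          ¬ VertexTraversals u ω n j z (4 * N) ((4 + ε) * N)),
      SAW.criticalFugacity ^ n

/-- **VirginShellCountCapped** — the refined atom: as `VirginShellCount`, but only for arcs whose
excursions beyond the virgin disc (traversals of `D(z;4N,(4+ε)N)`, any fixed `ε ∈ (0,1]`) are capped
by `j`; `m` may depend on `η, j, ε`. Exterior "pumping" of returns through nested handles reaching
distance `≥ εN` is thereby quarantined (the cap is paid for by the induction over concentric shells);
what the sup over `Λ` still contains is interior oscillation suppression plus thin rim-band handles. -/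
def VirginShellCountCapped : Prop :=
  ∀ η : ℝ, 0 < η → ∀ ε : ℝ, 0 < ε → ε ≤ 1 → ∀ j : ℕ, ∃ m N₀ : ℕ, ∀ N : ℕ, N₀ ≤ N →
    ∀ (z : ℂ) (Λ : Finset (Site 2)) (u u' : Site 2),
      (∀ v : Site 2, dist (Site.toComplex v) z < 4 * N → v ∈ Λ) →
      u ∈ Λ → u' ∈ Λ →
      4 * (N : ℝ) - 2 ≤ dist (Site.toComplex u) z → dist (Site.toComplex u) z ≤ 4 * N + 2 →
      4 * (N : ℝ) - 2 ≤ dist (Site.toComplex u') z → dist (Site.toComplex u') z ≤ 4 * N + 2 →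
      oscCapMass Λ u u' m j z N ε ≤ η * arcMass Λ u u'

/-- Top-down induction over the finitely many concentric shells of a FIXED shell (exits beyond the
virgin disc are traversals of a larger concentric shell, tight by the induction hypothesis; the chain
ends at shells meeting `∂Ω`, fixed geometries covered by the boundary companion). -/
def TopDown (BoundaryShellCountTight : Prop) : Prop :=
  VirginShellCountCapped → BoundaryShellCountTight → ShellCountTight

/-- The `x_c`-mass of SAWs from `u` (on the left side `x = 0`) that cross the lattice rectangle
`[0, L] × [0, W]` lengthwise inside it: vertices stay in the rectangle and the endpoint is on the right
side `x = L` (these are laterally confined bridges of span `L`). -/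
def rectCrossMass (W L : ℕ) (u : Site 2) : ℝ :=
  ∑ n ∈ Finset.range ((W + 1) * (L + 1) + 1),
    ∑ v ∈ (Finset.range (W + 1)).image (fun y : ℕ => (![(L : ℤ), (y : ℤ)] : Site 2)),
      ∑ _ω ∈ (SAW.Zd.sawFun 2 n (v - u)).filter
          (fun ω => ∀ i ≤ n, 0 ≤ (u + ω i) 0 ∧ (u + ω i) 0 ≤ L ∧ 0 ≤ (u + ω i) 1 ∧ (u + ω i) 1 ≤ W),
        SAW.criticalFugacity ^ n

/-- **StripGapUniform** (the corridor-decay ingredient for thin exterior handles; the transfer-matrix /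
Kesten-strip form of "long rectangles are exponentially hard to cross the long way", i.e. a uniform
lower bound `W · m_W(x_c) ≥ κ₀` on the strip mass gap at the bulk critical fugacity): there are `C` and
`κ₀ > 0` with `rectCrossMass W (t W) u ≤ C e^{-κ₀ t}` for all widths `W ≥ 1`, aspects `t ≥ 1` and
left-side starting points `u`. Open; numerically classical (phenomenological RG on strips). -/
def StripGapUniform : Prop :=
  ∃ C κ₀ : ℝ, 0 < κ₀ ∧ ∀ (W : ℕ), 1 ≤ W → ∀ (t : ℕ), 1 ≤ t → ∀ (y : ℕ), y ≤ W →
    rectCrossMass W (t * W) (![0, (y : ℤ)]) ≤ C * Real.exp (-κ₀ * t)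

/-! ## Card 2 — leaf peeling: one pinned-excursion rate -/

open Classical in
/-- The `x_c`-mass of arcs from `u` to `u'` in `Λ` that reach (Euclidean) distance `≥ L` from the
point `c` (an excursion of size `L` away from the box around `c`). -/
def excMass (Λ : Finset (Site 2)) (u u' : Site 2) (c : ℂ) (L : ℝ) : ℝ :=
  ∑ n ∈ Finset.range (Λ.card + 1),
    ∑ _ω ∈ ((SAW.Zd.sawFun 2 n (u' - u)).filter (fun ω => ∀ i ≤ n, u + ω i ∈ Λ)).filter
        (fun ω => ∃ i ≤ n, L ≤ dist (Site.toComplex (u + ω i)) c),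
      SAW.criticalFugacity ^ n

/-- **PocketExcursion** — the one-excursion RATE atom of card `leaf-peeling`: there are `C` and
`β > 0` such that for every box half-width `w ≥ 1`, every aspect `t ≥ 2`, every finite region
`Λ ⊆ ℤ²` containing the full lattice box `{|v - c|_∞ ≤ w}` (virgin box) and every two points
`u, u'` of that box, the `x_c`-mass of arcs from `u` to `u'` in `Λ` reaching distance `t·w` from
`c` is at most `C t^{-β}` times the mass of all arcs from `u` to `u'` in `Λ`. A sup over the
pocket `Λ` beyond the box; the local (non-excursion) alternative is fat by construction. -/
def PocketExcursion : Prop :=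
  ∃ C β : ℝ, 0 < β ∧ ∀ (w : ℕ), 1 ≤ w → ∀ (t : ℕ), 2 ≤ t →
    ∀ (Λ : Finset (Site 2)) (c u u' : Site 2),
      (∀ v : Site 2, (∀ i, |v i - c i| ≤ w) → v ∈ Λ) →
      (∀ i, |u i - c i| ≤ w) → (∀ i, |u' i - c i| ≤ w) →
      excMass Λ u u' (Site.toComplex c) (t * w) ≤ C * (t : ℝ) ^ (-β) * arcMass Λ u u'

/-- Shape of card 2's line: the one-excursion rate feeds the rate-free multi-oscillation atom of
card 1 through deterministic meander combinatorics (canonical leaf sets of the nesting forest,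
first/last-visit virgin boxes) and an upward induction over scales at fixed mesh. -/
def PeelingLine : Prop := PocketExcursion → VirginShellCount

/-- The honest shape once the exterior case of the leaf dichotomy is routed to card 1's capped atom:
peeling proves the CAPPED atom (interior oscillations), the cap being paid by the top-down induction. -/
def PeelingLineCapped : Prop := PocketExcursion → VirginShellCountCapped

end Summit.CriticalPhenomena.SAWScalingLimit.Cruxes.EventualTight.Ideator1

end
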